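import Summits.BirchSwinnertonDyer.BirchSwinnertonDyer.Theses.RamifiedSevenEllipticUnits
import Summits.BirchSwinnertonDyer.Rank1Residual.X12.CMSevenAwayFromSeven
import Literature.NumberTheory.EllipticCurves.KolyvaginShaStructureAnyLevel
import HarnessLib

set_option linter.dupNamespace false

/-!
# Sketch — crux idea `cuspidal-descent-kolyvagin-nonvanishing` for
# `EllipticUnitValueSevenOfGZK` (stmt-BirchSwinnertonDyer-19945), planner bsd-idea-20 g24; REV 2 g25; REV 3 g26

Typed first statements of the line (nothing proved; no summit statement is proved by this seat).

REV 2 (g25, 2026-08-28): TYPING DEFECT of REV 1 fixed in `KolyvaginNonvanishingModSevenTypeIII`.  The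
structure `ModularParametrizationData W N` only asks `c • periodLattice f ≤ Λ_W` of its integer `c`, so
with any datum `Dt₀` (constant `c₀`) the datum `[7] ∘ Dt₀` (constant `7c₀`, degree `49·deg₀`) is also a
term of the type, and EVERY Heegner / derived point built from it is `7`-divisible: REV 1's `∀ Dt, ∃ …, ¬ 7 ∣ P(n)`
was therefore FALSE AS TYPED (junk-multiple vacuity, class A of the refuter's audit).  REV 2 inserts the guard
`¬ (7 : ℤ) ∣ Dt.c` (for `7 ∤ c` the datum is `[m] ∘ Dt₀` with `7 ∤ m`, which does not change
`7`-divisibility of derived points; if `7 ∣ c₀(W)` the statement is vacuous in `Dt` and the consumer P2 must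
supply a datum with `7 ∤ c`, i.e. the Manin-type input `7 ∤ c₀(49a1^{(D)})` — price P-α of critic V#22s,
see the card REV 2, `What it needs`, P2).  `EisensteinCMKolyvaginStructureSeven` is unaffected (for
`[7] ∘ Dt₀` its hypothesis "some derived point is not 7-divisible" fails, so it is vacuously true there) and
`BSDpSevenOnClassCSeven` does not mention parametrisations.  Memo: `CuspidalDescentF1F2-g25.md`.

REV 3 (g26, 2026-08-29): statements UNCHANGED.  (i) The guard `¬ (7 : ℤ) ∣ Dt.c` is NON-VACUOUS at every
type-III member — price P-α′ of critic V#22t PAID by the support file `CuspidalDescentManinTransport.lean`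
(this directory; kernel-checked, 0 sorries): an `X₀`-datum `(f, Λ, c)` transports along a quadratic twist by
a prime discriminant WITH THE SAME constant `c` (Stevens' twisting argument on `Γ₀`, all inputs proved in
the tree: `exists_datum_c_eq_of_quadraticTwist_pStar`, `…_two`, conductor-level forms, isogeny step), so
from Cremona's `Λ_{f₄₉} = Λ_{49A1}` (`c = 1`) every `49a1^{(D)}` carries an `X₀(N(W))`-datum with `c = 1`
and every `49a2^{(D)}` (the other member with `v₇(Δ) = 3`) one with `c ∣ 2` — no optimality of any member
is needed (memo `CuspidalDescentManin-g26.md`).  (ii) `set_option linter.dupNamespace false` (critic nit).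

* `KolyvaginNonvanishingModSevenTypeIII` — Kolyvagin's conjecture MOD 7 (`𝓜_∞ = 0`) for the
  Kodaira-type-III members `E_D = 49a1^{(D)}` (`D < 0`, `7 ∤ D`) of the class `𝒞₇`, over SOME
  auxiliary Heegner field `K''`: some derived Heegner point `P(n)` of square-free Kolyvagin level `n`
  is not `7`-divisible in `E(K''[n])`.  This is the TRANSFER TARGET `C⁺` (first half) of the card;
  the card's lever (cuspidal `φ̂`-descent on `X₀(49)` + primitivity of the elliptic-unit Kolyvagin
  system of `K''`) is a route to it that uses no `7`-adic `L`-function, no reciprocity law and no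
  height at the additive prime `7`.
* `EisensteinCMKolyvaginStructureSeven` — the Kolyvagin–McCallum EXACT order of `Ш(E_D/K'')[7^∞]`
  from one non-divisible derived point, i.e. the tree's
  `McCallum1991_card_sha_primary_baseChange_of_derivedPoint_not_divisible_anyLevel` with its two
  hypotheses that FAIL here (`¬ W.HasCM`, surjective mod-`7^k` image) replaced by membership in
  `𝒞₇` (type III) — the second half of `C⁺` (crux K2 of the card).
* `BSDpSevenOnClassCSeven` — the consequence in Miller's currency (`BSDp W 7` on all of `𝒞₇`, both
  isogeny partners), from which the route's `(★_an)` value law follows by the route's ASIDE A.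
-/

noncomputable section

open scoped Classical

open WeierstrassCurve Literature.NumberTheory.EllipticCurves
  Literature.NumberTheory.EllipticCurves.ModularForms
  Summit.BirchSwinnertonDyer.Rank1Residual.X12

namespace Summit.BirchSwinnertonDyer.BirchSwinnertonDyer.Cruxes.EllipticUnitValueSevenOfGZK.CuspidalDescent

/-- **C⁺ (i): Kolyvagin's conjecture mod 7 on the type-III stratum of 𝒞₇.** For every globally
minimal `W ∈ 𝒞₇` of Kodaira type III at `7` (`ord₇ Δ_min = 3`, i.e. `W = 49a1^{(D)}`, `D < 0`,
`7 ∤ D` — the member whose rational `7`-isogeny kernel `𝔽₇(ω⁵χ_D)` is an EVEN character) and every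
modular parametrisation datum WITH `7 ∤ c` (REV 2 guard: excludes the junk data `[7] ∘ Dt₀`; see the
module docstring), there are an imaginary quadratic `K''` (`d_{K''} ∉ {−3,−4}`, Heegner hypothesis for
`N(W) = 49D²`), an orientation, a square-free product `n` of Kolyvagin primes for `(W, K'', 7)` and a
Kolyvagin datum of level `n` whose derived point `P(n)` is not `7`-divisible in `E(K''[n])`. -/
def KolyvaginNonvanishingModSevenTypeIII : Prop :=
  ∀ (W : WeierstrassCurve ℚ) [W.IsElliptic] [W.IsGloballyMinimal] [NeZero (W.conductorNorm ℤ)]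
    [Fact (Nat.Prime 7)],
    ClassCSeven W → padicValRat 7 W.Δ = 3 →
    ∀ (Dt : ModularParametrizationData W (W.conductorNorm ℤ)), ¬ (7 : ℤ) ∣ Dt.c →
    ∃ (K : Type) (_ : Field K) (_ : NumberField K),
      IsImaginaryQuadratic K ∧ NumberField.discr K ≠ -3 ∧ NumberField.discr K ≠ -4 ∧
      SatisfiesHeegnerHypothesis (W.conductorNorm ℤ) K ∧
      ∃ (β : ℤ) (ι : K →+* ℂ) (n : ℕ) (d : KolyvaginHeegnerData Dt β ι n),
        Squarefree n ∧
        (∀ ℓ ∈ n.primeFactors, Zhang2014.IsKolyvaginPrime (W.conductorNorm ℤ) W K 7 ℓ) ∧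
        ¬ ∃ Q : (W.baseChange (ringClassField K ι n)).toAffine.Point, (7 : ℤ) • Q = d.derivedPoint

/-- **C⁺ (ii): the Kolyvagin–McCallum exact order at the Eisenstein prime 7 with CM** (crux K2):
McCallum's any-level theorem with `¬ W.HasCM` and the surjective mod-`7^k` image replaced by
`W ∈ 𝒞₇` of type III at `7`. -/
def EisensteinCMKolyvaginStructureSeven : Prop :=
  ∀ (W : WeierstrassCurve ℚ) [W.IsElliptic] [W.IsGloballyMinimal] [NeZero (W.conductorNorm ℤ)]
    [Fact (Nat.Prime 7)],
    ClassCSeven W → padicValRat 7 W.Δ = 3 →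
    ∀ (K : Type) [Field K] [NumberField K], IsImaginaryQuadratic K →
    NumberField.discr K ≠ -3 → NumberField.discr K ≠ -4 →
    SatisfiesHeegnerHypothesis (W.conductorNorm ℤ) K →
    ∀ (Dt : ModularParametrizationData W (W.conductorNorm ℤ)) (β : ℤ) (ι : K →+* ℂ)
      (d₁ : KolyvaginHeegnerData Dt β ι 1), ¬ IsOfFinAddOrder d₁.derivedPoint →
    ∀ (M₀ : ℕ),
      (∃ Q : (W.baseChange (ringClassField K ι 1)).toAffine.Point,
          ((7 ^ M₀ : ℕ) : ℤ) • Q = d₁.derivedPoint) →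
      (¬ ∃ Q : (W.baseChange (ringClassField K ι 1)).toAffine.Point,
          ((7 ^ (M₀ + 1) : ℕ) : ℤ) • Q = d₁.derivedPoint) →
    ∀ (n : ℕ) (d : KolyvaginHeegnerData Dt β ι n), Squarefree n →
      (∀ ℓ ∈ n.primeFactors, Zhang2014.IsKolyvaginPrime (W.conductorNorm ℤ) W K 7 ℓ) →
      (¬ ∃ Q : (W.baseChange (ringClassField K ι n)).toAffine.Point, (7 : ℤ) • Q = d.derivedPoint) →
    Nat.card (AddCommGroup.primaryComponent (W.baseChange K).sha 7) = 7 ^ (2 * M₀)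

/-- **Target of the transfer in Miller's currency**: `BSD(W, 7)` for every `W ∈ 𝒞₇` (from C⁺ (i),
(ii), Gross–Zagier bookkeeping over `K''`, the CM rank-0 fact for the twin `W^{(d_{K''})}` and
Cassels' isogeny invariance for the type-III* partner). The route's `(★_an)` law
`RamifiedCMBottomClassIndexLawAtZp W 7` then follows by the route's ASIDE A (EU-alg). -/
def BSDpSevenOnClassCSeven : Prop :=
  ∀ (W : WeierstrassCurve ℚ) [W.IsElliptic] [W.IsGloballyMinimal] [Fact (Nat.Prime 7)],
    ClassCSeven W → BSDp W 7

/-- The crux this card is attached to (by name, for the audit). -/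
example : Prop := Summit.BirchSwinnertonDyer.BirchSwinnertonDyer.Theses.RamifiedSevenEllipticUnits.EllipticUnitValueSevenOfGZK

end Summit.BirchSwinnertonDyer.BirchSwinnertonDyer.Cruxes.EllipticUnitValueSevenOfGZK.CuspidalDescent

end
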